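/-
Copyright: rh-split cell (dbn column, prover seat l19-w2) gen 0, 2026-08-27.  LINE 3 «two-ray Laguerre
squeeze» of ideator rh-idea-2 (D-0145).  The linear-factor ray `HasOnlyRealZeros (linearFactorH a)` is an
RH-STRENGTHENING conjunct (`LinearRayTwoPoint.riemannHypothesis_of_linearRay`); everything here is a
CONDITIONAL certificate GIVEN the ray.  Nothing here bears on the truth of RH.
-/
import Summits.RiemannHypothesis.RiemannHypothesis.Theorems.Splittings.LinearRayZeroSigns
import Summits.RiemannHypothesis.RiemannHypothesis.Theorems.Splittings.LinearRaySwingCore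
import Summits.RiemannHypothesis.RiemannHypothesis.Theorems.UniversalFactorLaplaceLoopholeSignCriterion
import HarnessLib

/-!
# The swing lemma for the Laplace-smoothed factor `F_a` between consecutive simple zeros of `H_0`

Item `DBN.LinearRaySwingLemma` (stmt-RiemannHypothesis-22393, LINE 3 «two-ray Laguerre squeeze» of
rh-idea-2), UNFOLDED (`linearRaySwingLemma`; the by-name closer is `Theorems/Splittings/LinearRaySwingLemma.lean`):
for `a > 0`, GIVEN the ray `HasOnlyRealZeros (linearFactorH a)`, if `x₁ < x₂` are consecutive SIMPLE real zeros
of `H_0 = deBruijnH 0` (`H_0(x₁) = H_0(x₂) = 0`, `H_0^{(1)}(x_i) ≠ 0`, no zero in between) with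
`a (x₂ − x₁) ≤ 1`, then somewhere on `[x₁, x₂]` the two-sided factor `F_a = deBruijnHDiv (1 + u²/a²)` is squeezed:
`|Re F_a(y)| ≤ a (x₂ − x₁) |Re H_0(y)|`.

PROOF = the abstract swing lemma `LinearRaySwingCore.exists_abs_le_of_swing` fed with `f = Re F_a`, `h = Re H_0`
on the real axis: `f'' = a² (f − h)` is the real part of the tree ODE `F_a − F_a''/a² = H_0`
(`deBruijnHDiv_laplace_sub_deriv_deriv`), `h' = Re H_0^{(1)}` (`LinearRayZeroSigns.hasDerivAt_deBruijnH_zero`;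
`H_0` real on `ℝ` by `UniversalFactor.deBruijnH_zero_ofReal_im`), and
the four endpoint sign rules `(f ± f'/a)(x_i) · h'(x_i) ≷ 0` are the two one-point Laguerre certificates
`LinearRayZeroSigns.re_linearFactorH_mul_nonneg` / `re_linearFactorH_neg_mul_nonpos` at `x₁` and `x₂`, read through
`linearFactorH (±a) = F_a ± F_a'/a` (`linearFactorH_eq_deBruijnHDiv_add_deriv`, kernel even in `a`).

This file declares no definitions.  No `sorry`, no new axioms, no instances, no notation.  A CONDITIONAL
certificate given the RH-strengthening ray; nothing here bears on the truth of RH.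
-/

set_option linter.dupNamespace false  -- the mandated namespace repeats `RiemannHypothesis`

namespace Summit.RiemannHypothesis.RiemannHypothesis.Theorems.Splittings.LinearRaySwing

open Complex Filter Topology Set
open Literature.NumberTheory.LFunctions Literature.Analysis.Complex
open Literature.Barriers.RiemannHypothesis (linearFactorH linearFactorH_eq_deBruijnHDiv_add_deriv)
open Summit.RiemannHypothesis.RiemannHypothesis.Theorems
open Summit.RiemannHypothesis.RiemannHypothesis.Theorems.Splittings.LinearRayZeroSigns
open Summit.RiemannHypothesis.RiemannHypothesis.Theorems.Splittings.LinearRaySwingCore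

/-! ## Real calculus for `Re F_a` and `Re H_0` on the real axis -/

/-- `x ↦ Re F_a(x)` has derivative `Re F_a'(x)` on `ℝ`. [folklore] -/
theorem hasDerivAt_re_laplaceFactor (a x : ℝ) :
    HasDerivAt (fun t : ℝ ↦ (deBruijnHDiv (fun u : ℝ => 1 + u ^ 2 / a ^ 2) t).re)
      ((deriv (deBruijnHDiv fun u : ℝ => 1 + u ^ 2 / a ^ 2) x).re) x := by
  have h1 : HasDerivAt (fun t : ℝ ↦ deBruijnHDiv (fun u : ℝ => 1 + u ^ 2 / a ^ 2) t)
      (deriv (deBruijnHDiv fun u : ℝ => 1 + u ^ 2 / a ^ 2) x) x :=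
    ((differentiable_deBruijnHDiv_laplace a) x).hasDerivAt.comp_ofReal
  have h2 := (Complex.reCLM.hasFDerivAt).comp_hasDerivAt x h1
  simpa [Function.comp_def] using h2

/-- The ODE solved for the second derivative: `F_a'' = a² (F_a − H_0)` on `ℂ` (`a ≠ 0`;
`deBruijnHDiv_laplace_sub_deriv_deriv`). [folklore] -/
theorem deriv_deriv_laplaceFactor {a : ℝ} (ha : a ≠ 0) (z : ℂ) :
    deriv (deriv (deBruijnHDiv fun u : ℝ => 1 + u ^ 2 / a ^ 2)) z
      = (a : ℂ) ^ 2 * (deBruijnHDiv (fun u : ℝ => 1 + u ^ 2 / a ^ 2) z - deBruijnH 0 z) := by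
  have ha2 : (a : ℂ) ^ 2 ≠ 0 := pow_ne_zero 2 (by exact_mod_cast ha)
  have h := deBruijnHDiv_laplace_sub_deriv_deriv a z
  have h' : deriv (deriv (deBruijnHDiv fun u : ℝ => 1 + u ^ 2 / a ^ 2)) z / (a : ℂ) ^ 2
      = deBruijnHDiv (fun u : ℝ => 1 + u ^ 2 / a ^ 2) z - deBruijnH 0 z := by
    rw [← h]
    ring
  rw [div_eq_iff ha2] at h'
  rw [h']
  ring

/-- `x ↦ Re F_a'(x)` has derivative `a² (Re F_a(x) − Re H_0(x))` on `ℝ` (`a ≠ 0`). [folklore] -/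
theorem hasDerivAt_re_deriv_laplaceFactor {a : ℝ} (ha : a ≠ 0) (x : ℝ) :
    HasDerivAt (fun t : ℝ ↦ (deriv (deBruijnHDiv fun u : ℝ => 1 + u ^ 2 / a ^ 2) t).re)
      (a ^ 2 * ((deBruijnHDiv (fun u : ℝ => 1 + u ^ 2 / a ^ 2) x).re - (deBruijnH 0 x).re)) x := by
  have hFd := differentiable_deBruijnHDiv_laplace a
  have h1 : HasDerivAt (fun t : ℝ ↦ deriv (deBruijnHDiv fun u : ℝ => 1 + u ^ 2 / a ^ 2) t)
      (deriv (deriv (deBruijnHDiv fun u : ℝ => 1 + u ^ 2 / a ^ 2)) x) x :=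
    ((hFd.deriv) x).hasDerivAt.comp_ofReal
  have h2 := (Complex.reCLM.hasFDerivAt).comp_hasDerivAt x h1
  have h3 : HasDerivAt (fun t : ℝ ↦ (deriv (deBruijnHDiv fun u : ℝ => 1 + u ^ 2 / a ^ 2) t).re)
      ((deriv (deriv (deBruijnHDiv fun u : ℝ => 1 + u ^ 2 / a ^ 2)) x).re) x := by
    simpa [Function.comp_def] using h2
  refine h3.congr_deriv ?_
  rw [deriv_deriv_laplaceFactor ha, show ((a : ℂ) ^ 2) = ((a ^ 2 : ℝ) : ℂ) by push_cast; ring,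
    Complex.re_ofReal_mul, Complex.sub_re]

/-- `x ↦ Re H_0(x)` has derivative `Re H_0^{(1)}(x)` on `ℝ`. [folklore] -/
theorem hasDerivAt_re_deBruijnH_zero (x : ℝ) :
    HasDerivAt (fun t : ℝ ↦ (deBruijnH 0 t).re) ((deBruijnH0Deriv 1 x).re) x := by
  have h1 : HasDerivAt (fun t : ℝ ↦ deBruijnH 0 t) (deBruijnH0Deriv 1 x) x :=
    (hasDerivAt_deBruijnH_zero x).comp_ofReal
  have h2 := (Complex.reCLM.hasFDerivAt).comp_hasDerivAt x h1
  simpa [Function.comp_def] using h2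

/-! ## The two mirror members in terms of `F_a` on the real axis -/

/-- `Re linearFactorH a (x) = Re F_a(x) + Re F_a'(x)/a` (for `a = 0` both sides are junk-equal). [folklore] -/
theorem re_linearFactorH_eq (a x : ℝ) :
    (linearFactorH a x).re = (deBruijnHDiv (fun u : ℝ => 1 + u ^ 2 / a ^ 2) x).re
      + (deriv (deBruijnHDiv fun u : ℝ => 1 + u ^ 2 / a ^ 2) x).re / a := by
  rw [linearFactorH_eq_deBruijnHDiv_add_deriv, Complex.add_re, ← Complex.ofReal_inv, Complex.re_ofReal_mul,
    inv_mul_eq_div]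

/-- `Re linearFactorH (−a) (x) = Re F_a(x) − Re F_a'(x)/a` (the kernel `1 + u²/a²` is even in `a`). [folklore] -/
theorem re_linearFactorH_neg_eq (a x : ℝ) :
    (linearFactorH (-a) x).re = (deBruijnHDiv (fun u : ℝ => 1 + u ^ 2 / a ^ 2) x).re
      - (deriv (deBruijnHDiv fun u : ℝ => 1 + u ^ 2 / a ^ 2) x).re / a := by
  have hk : (fun u : ℝ => 1 + u ^ 2 / (-a) ^ 2) = (fun u : ℝ => 1 + u ^ 2 / a ^ 2) := by
    funext u
    rw [neg_sq]
  rw [linearFactorH_eq_deBruijnHDiv_add_deriv, hk, Complex.add_re, ← Complex.ofReal_inv, Complex.re_ofReal_mul,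
    inv_neg]
  ring

/-! ## The swing lemma -/

/-- **Swing lemma** (item `DBN.LinearRaySwingLemma` of route `DBN`, stmt-RiemannHypothesis-22393, UNFOLDED).
For `a > 0`, GIVEN the ray `HasOnlyRealZeros (linearFactorH a)`: if `x₁ < x₂` with `a (x₂ − x₁) ≤ 1` are simple
real zeros of `H_0` with no zero of `H_0` strictly between them, then for some `y ∈ [x₁, x₂]`,
`|Re F_a(y)| ≤ a (x₂ − x₁) |Re H_0(y)|` (`F_a = deBruijnHDiv (1 + u²/a²)`).  A CONDITIONAL certificate given
the RH-strengthening ray; nothing here bears on the truth of RH. -/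
theorem linearRaySwingLemma {a : ℝ} (ha : 0 < a) (hRay : HasOnlyRealZeros (linearFactorH a)) {x₁ x₂ : ℝ}
    (hx : x₁ < x₂) (haδ : a * (x₂ - x₁) ≤ 1)
    (hx₁ : deBruijnH 0 ((x₁ : ℝ) : ℂ) = 0) (hx₂ : deBruijnH 0 ((x₂ : ℝ) : ℂ) = 0)
    (hd₁ : deBruijnH0Deriv 1 ((x₁ : ℝ) : ℂ) ≠ 0) (hd₂ : deBruijnH0Deriv 1 ((x₂ : ℝ) : ℂ) ≠ 0)
    (hgap : ∀ z ∈ Set.Ioo x₁ x₂, deBruijnH 0 ((z : ℝ) : ℂ) ≠ 0) :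
    ∃ y ∈ Set.Icc x₁ x₂, |(deBruijnHDiv (fun u : ℝ => 1 + u ^ 2 / a ^ 2) ((y : ℝ) : ℂ)).re|
      ≤ a * (x₂ - x₁) * |(deBruijnH 0 ((y : ℝ) : ℂ)).re| := by
  have ha0 : a ≠ 0 := ha.ne'
  -- the data of the abstract swing lemma
  have hne : ∀ z ∈ Ioo x₁ x₂, (deBruijnH 0 ((z : ℝ) : ℂ)).re ≠ 0 := fun z hz h0 ↦
    hgap z hz (Complex.ext (by simpa using h0) (by simpa using UniversalFactor.deBruijnH_zero_ofReal_im z))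
  have r₁p := re_linearFactorH_mul_nonneg ha hRay hx₁
  have r₁m := re_linearFactorH_neg_mul_nonpos ha hRay hx₁
  have r₂p := re_linearFactorH_mul_nonneg ha hRay hx₂
  have r₂m := re_linearFactorH_neg_mul_nonpos ha hRay hx₂
  rw [re_linearFactorH_eq] at r₁p r₂p
  rw [re_linearFactorH_neg_eq] at r₁m r₂m
  exact exists_abs_le_of_swing
    (f := fun t : ℝ ↦ (deBruijnHDiv (fun u : ℝ => 1 + u ^ 2 / a ^ 2) t).re)
    (f' := fun t : ℝ ↦ (deriv (deBruijnHDiv fun u : ℝ => 1 + u ^ 2 / a ^ 2) t).re)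
    (h := fun t : ℝ ↦ (deBruijnH 0 t).re) (h' := fun t : ℝ ↦ (deBruijnH0Deriv 1 t).re)
    ha hx haδ (hasDerivAt_re_laplaceFactor a) (fun x ↦ hasDerivAt_re_deriv_laplaceFactor ha0 x)
    hasDerivAt_re_deBruijnH_zero (by simp [hx₁]) (by simp [hx₂]) hne
    (re_deBruijnH0Deriv_one_ne_zero hd₁) (re_deBruijnH0Deriv_one_ne_zero hd₂) r₁p r₁m r₂p r₂m

end Summit.RiemannHypothesis.RiemannHypothesis.Theorems.Splittings.LinearRaySwing
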